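import Literature.Topology.Immersions.HolonomicApproximationInterpolation
import Literature.Topology.Immersions.HolonomicApproximationWiggle
import HarnessLib

/-!
# Holonomic approximation: gluing a continuous family of holonomic sections along a wiggled segment

Topic `Literature/Topology/Immersions`; the central construction of the proof of the
**Inductional Lemma** of Eliashberg–Mishachev (2001, Lemma 1.3.2), in the case of a
one-dimensional cube `I = [0, 1] × 0 ⊂ ℝⁿ⁺²` and of the fibration by points (`l = 1`): from a
continuous family `(f_s)_{s ∈ ℝ}` of genuine maps `ℝⁿ⁺² → F` whose `1`-jets are `ε/4`-close to a
`1`-jet section `(F₀, F₁)` on balls of radius `d` around the points `c(s) = s e₀` of the core,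
constant near the two ends, we build — for every `δ > 0` — a wiggle `φ_N` of amplitude `≤ δ`, and
a **single** `C^∞` map `g` whose `1`-jet is `ε`-close to `(F₀, F₁)` on a neighbourhood `Ω` of the
wiggled core `h(I)`, `h = shear φ_N`, and which coincides with `f₀`, `f₁` near the ends.

Construction (EM 2001, proof of Lemma 1.3.2). Sample the family at `s_j = j/(2N)`; the pieces
are `p_j = f_{s_j}` for even `j` and, for odd `j`, the transverse interpolation of
`f_{s_{j-1}}` (bottom, `x₁ ≤ -δ₀/2`) and `f_{s_{j+1}}` (top, `x₁ ≥ δ₀/2`) — genuine maps whose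
`1`-jets are still close to `(F₀, F₁)` because consecutive members of the family are `C⁰`-close
(uniform continuity, `N` large) compared with the fixed slope `~1/δ₀` of the cut-off
(`norm_fderiv_transverseInterp_sub_le`). Consecutive pieces `p_{j-1}`, `p_j` **agree** on the
top half-space (`j` even) or the bottom one (`j` odd); the wiggle `φ_N` takes the core near the
junction slice `x₀ = s_j` into that half-space (`abs_wiggle_ge_of_abs_sub_le`). The pieces are
glued in the core direction by a telescoping smooth partition of unity
`g = p₀ + ∑ⱼ ζⱼ(x₀) (pⱼ - pⱼ₋₁)`, `ζⱼ` a smooth step across the junction window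
`|x₀ - s_j| < w = 1/(48N)`; on `Ω` the gluing terms `ζⱼ'(x₀) (pⱼ x - pⱼ₋₁ x)` vanish identically,
so that `g` is, at every point of `Ω`, a convex combination of two consecutive pieces.

* `Literature.Topology.Immersions.coreLine n s = s • e₀`, `sample N j = j / (2N)`,
  `piece θ f N j` (the pieces `pⱼ`), `junctionStep N w j` (`ζⱼ`), `glued θ f N w` (`g`),
  `IsGluingFamily f F₀ F₁ ε d η` (the hypotheses on the family).
* `Literature.Topology.Immersions.hasFDerivAt_glued`, `add_sum_smul_sub_eq`,
  `exists_junctionStep_pattern`, `piece_eq_piece_pred`, `piece_approx` — the derivative of the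
  glued map, the telescoping evaluation, the `1,…,1,λ,0,…,0` pattern of the `ζⱼ(x₀)`, the
  agreement of consecutive pieces near the junctions along the wiggled core, and the `1`-jet
  estimates for the pieces.
* `Literature.Topology.Immersions.exists_glue_family_along_wiggle` — the gluing theorem above.

Everything is **proved**; the `def`s are explicit formulas.

## References

* Y. Eliashberg, N. Mishachev, *Holonomic approximation and Gromov's h-principle*,
  arXiv:math/0101196 (2001), Lemma 1.3.2 (proof: Interpolation Property, `θ_N`, `φ_N`, `h`,
  `F̃`). [EliashbergMishachev2001]
* Y. Eliashberg, N. Mishachev, *Introduction to the h-principle*, GSM 48, AMS (2002), Ch. 3.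
  [EliashbergMishachev2002]
-/

open Set Function Filter Metric Real
open scoped Topology ContDiff

noncomputable section

namespace Literature.Topology.Immersions

open Literature.Topology.FourManifolds (smoothStep smoothStep_of_le smoothStep_of_ge
  smoothStep_mem_Icc contDiff_smoothStep hasDerivAt_smoothStep deriv_smoothStep_of_lt
  deriv_smoothStep_of_gt)

variable {n : ℕ} {F : Type*} [NormedAddCommGroup F] [NormedSpace ℝ F]

/-- Local notation: the model space `ℝⁿ⁺²` (at least two coordinates: the core direction `0`
and the wiggling direction `1`). -/
local notation "𝔼₂" => EuclideanSpace ℝ (Fin (n + 2))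

/-! ### The core segment and the sample slices -/

/-- The core line `c(s) = s e₀` of `ℝⁿ⁺²`; the core segment is `c '' [0, 1]`.
[cite: EliashbergMishachev2001, Thm. 1.3.1] -/
def coreLine (n : ℕ) (s : ℝ) : EuclideanSpace ℝ (Fin (n + 2)) :=
  s • EuclideanSpace.single 0 (1 : ℝ)

/-- Coordinates of the core line: `c(s)₀ = s`. [folklore] -/
@[simp]
theorem coreLine_apply_zero (s : ℝ) : coreLine n s 0 = s := by
  simp [coreLine]

/-- Coordinates of the core line: `c(s)ₖ = 0` for `k ≠ 0`. [folklore] -/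
theorem coreLine_apply_of_ne (s : ℝ) {k : Fin (n + 2)} (hk : k ≠ 0) : coreLine n s k = 0 := by
  simp [coreLine, hk]

/-- `‖c(s) - c(s')‖ = |s - s'|`. [folklore] -/
theorem norm_coreLine_sub (s s' : ℝ) : ‖coreLine n s - coreLine n s'‖ = |s - s'| := by
  rw [coreLine, coreLine, ← sub_smul, norm_smul, Real.norm_eq_abs]
  simp

/-- The core line is continuous. [folklore] -/
theorem continuous_coreLine : Continuous (coreLine n) :=
  continuous_id.smul continuous_const

/-- The sample slices `s_j = j / (2N)`. [cite: EliashbergMishachev2001, Lemma 1.3.2] -/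
def sample (N j : ℕ) : ℝ := j / (2 * N)

/-- Unfolding lemma for `sample`. [folklore] -/
theorem sample_eq (N j : ℕ) : sample N j = j / (2 * N) := rfl

/-- Consecutive samples differ by `1/(2N)`. [folklore] -/
theorem sample_succ_sub {N : ℕ} (hN : 0 < N) (j : ℕ) : sample N (j + 1) - sample N j = 1 / (2 * N) := by
  have hN' : (N : ℝ) ≠ 0 := by exact_mod_cast hN.ne'
  simp only [sample, Nat.cast_add, Nat.cast_one]
  field_simp
  ring

/-- Samples two apart differ by `1/N`. [folklore] -/
theorem sample_add_two_sub {N : ℕ} (hN : 0 < N) (j : ℕ) : sample N (j + 2) - sample N j = 1 / N := by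
  have hN' : (N : ℝ) ≠ 0 := by exact_mod_cast hN.ne'
  simp only [sample, Nat.cast_add, Nat.cast_ofNat]
  field_simp
  ring

/-- Samples are monotone in `j`. [folklore] -/
theorem sample_le_sample {N : ℕ} (hN : 0 < N) {j j' : ℕ} (h : j ≤ j') : sample N j ≤ sample N j' := by
  unfold sample
  gcongr

/-- `s_0 = 0`. [folklore] -/
@[simp]
theorem sample_zero (N : ℕ) : sample N 0 = 0 := by simp [sample]

/-- `s_{2N} = 1`. [folklore] -/
theorem sample_two_mul {N : ℕ} (hN : 0 < N) : sample N (2 * N) = 1 := by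
  have hN' : (N : ℝ) ≠ 0 := by exact_mod_cast hN.ne'
  simp only [sample, Nat.cast_mul, Nat.cast_ofNat]
  field_simp

/-! ### The transverse cut-off and its slope -/

/-- **A bounded slope for smooth steps**: the derivative of the tree's `smoothStep a b`
(`a < b`) is bounded on `ℝ` (it is continuous and vanishes off `[a, b]`). [folklore] -/
theorem exists_abs_deriv_smoothStep_le {a b : ℝ} (hab : a < b) :
    ∃ K : ℝ, 0 ≤ K ∧ ∀ t, |deriv (smoothStep a b) t| ≤ K := by
  have hc : Continuous (deriv (smoothStep a b)) :=
    (contDiff_smoothStep a b).continuous_deriv (by simp)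
  obtain ⟨K, hK⟩ := isCompact_Icc.exists_bound_of_continuousOn (s := Icc a b) hc.continuousOn
  refine ⟨max K 0, le_max_right _ _, fun t => ?_⟩
  rcases lt_trichotomy t a with ht | rfl | ht
  · rw [deriv_smoothStep_of_lt hab ht, abs_zero]
    exact le_max_right _ _
  · exact (Real.norm_eq_abs _ ▸ hK t ⟨le_rfl, hab.le⟩).trans (le_max_left _ _)
  · rcases lt_or_ge b t with hbt | hbt
    · rw [deriv_smoothStep_of_gt hab hbt, abs_zero]
      exact le_max_right _ _
    · exact (Real.norm_eq_abs _ ▸ hK t ⟨ht.le, hbt⟩).trans (le_max_left _ _)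

/-! ### Uniform continuity of the family in the parameter -/

omit [NormedSpace ℝ F] in
/-- **Consecutive members of a continuous family are `C⁰`-close** (EM 2001, proof of
Lemma 1.3.2, "`σ(N) → 0`"): if `(s, x) ↦ f s x` is continuous then for every `ε' > 0` there is
`τ > 0` such that `‖f s x - f s' x‖ < ε'` whenever `s, s' ∈ [-1, 2]`, `|s - s'| ≤ τ` and
`‖x‖ ≤ R` (uniform continuity on a compact set). [cite: EliashbergMishachev2001, Lemma 1.3.2] -/
theorem exists_forall_norm_sub_lt_of_continuous_family {f : ℝ → 𝔼₂ → F}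
    (hc : Continuous fun q : ℝ × 𝔼₂ => f q.1 q.2) (R : ℝ) {ε' : ℝ} (hε' : 0 < ε') :
    ∃ τ > 0, ∀ s ∈ Icc (-1 : ℝ) 2, ∀ s' ∈ Icc (-1 : ℝ) 2, |s - s'| ≤ τ →
      ∀ x : 𝔼₂, ‖x‖ ≤ R → ‖f s x - f s' x‖ < ε' := by
  have hK : IsCompact (Icc (-1 : ℝ) 2 ×ˢ closedBall (0 : 𝔼₂) R) :=
    isCompact_Icc.prod (isCompact_closedBall 0 R)
  have hu := hK.uniformContinuousOn_of_continuous hc.continuousOn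
  rw [Metric.uniformContinuousOn_iff] at hu
  obtain ⟨τ, hτ, hτ'⟩ := hu ε' hε'
  refine ⟨τ / 2, half_pos hτ, fun s hs s' hs' hss' x hx => ?_⟩
  have hxR : x ∈ closedBall (0 : 𝔼₂) R := mem_closedBall_zero_iff.2 hx
  have hd : dist ((s, x) : ℝ × 𝔼₂) (s', x) < τ := by
    rw [Prod.dist_eq, dist_self, max_eq_left dist_nonneg, Real.dist_eq]
    linarith
  have key := hτ' (s, x) ⟨hs, hxR⟩ (s', x) ⟨hs', hxR⟩ hd
  rwa [dist_eq_norm] at key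

/-! ### The pieces and the glued map -/

/-- The transverse coordinate functional `x ↦ x₁`. [folklore] -/
abbrev projOne (n : ℕ) : EuclideanSpace ℝ (Fin (n + 2)) →L[ℝ] ℝ := EuclideanSpace.proj 1

/-- The **pieces** `pⱼ` (EM's `Gⁱ`): `f_{s_j}` for even `j`, and for odd `j` the transverse
interpolation of `f_{s_{j-1}}` (bottom) and `f_{s_{j+1}}` (top) by the cut-off `θ(x₁)`.
[cite: EliashbergMishachev2001, Lemma 1.3.2] -/
def piece (θ : ℝ → ℝ) (f : ℝ → 𝔼₂ → F) (N j : ℕ) : 𝔼₂ → F :=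
  if Even j then f (sample N j)
  else transverseInterp θ (projOne n) (f (sample N (j - 1))) (f (sample N (j + 1)))

/-- The piece of even index. [folklore] -/
theorem piece_of_even {θ : ℝ → ℝ} {f : ℝ → 𝔼₂ → F} {N j : ℕ} (hj : Even j) :
    piece θ f N j = f (sample N j) := by
  simp [piece, hj]

/-- The piece of odd index. [folklore] -/
theorem piece_of_odd {θ : ℝ → ℝ} {f : ℝ → 𝔼₂ → F} {N j : ℕ} (hj : ¬ Even j) :
    piece θ f N j = transverseInterp θ (projOne n) (f (sample N (j - 1))) (f (sample N (j + 1))) := by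
  simp [piece, hj]

/-- The pieces are `C^∞` when the family and the cut-off are. [folklore] -/
theorem contDiff_piece {θ : ℝ → ℝ} (hθ : ContDiff ℝ ∞ θ) {f : ℝ → 𝔼₂ → F}
    (hf : ∀ s, ContDiff ℝ ∞ (f s)) (N j : ℕ) : ContDiff ℝ ∞ (piece θ f N j) := by
  by_cases hj : Even j
  · rw [piece_of_even hj]
    exact hf _
  · rw [piece_of_odd hj]
    exact contDiff_transverseInterp hθ (hf _) (hf _)

/-- The junction cut-offs `ζⱼ(t) = smoothStep (s_j - w) (s_j + w) t`. [cite: EliashbergMishachev2001, Lemma 1.3.2] -/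
def junctionStep (N : ℕ) (w : ℝ) (j : ℕ) (t : ℝ) : ℝ :=
  smoothStep (sample N j - w) (sample N j + w) t

/-- `ζⱼ = 0` left of its window. [folklore] -/
theorem junctionStep_of_le {N : ℕ} {w : ℝ} (hw : 0 < w) {j : ℕ} {t : ℝ}
    (ht : t ≤ sample N j - w) : junctionStep N w j t = 0 :=
  smoothStep_of_le (by linarith) ht

/-- `ζⱼ = 1` right of its window. [folklore] -/
theorem junctionStep_of_ge {N : ℕ} {w : ℝ} (hw : 0 < w) {j : ℕ} {t : ℝ}
    (ht : sample N j + w ≤ t) : junctionStep N w j t = 1 :=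
  smoothStep_of_ge (by linarith) ht

/-- `0 ≤ ζⱼ ≤ 1`. [folklore] -/
theorem junctionStep_mem_Icc (N : ℕ) (w : ℝ) (j : ℕ) (t : ℝ) :
    junctionStep N w j t ∈ Icc (0 : ℝ) 1 :=
  smoothStep_mem_Icc _ _ _

/-- Off its closed window the derivative of `ζⱼ` vanishes. [folklore] -/
theorem deriv_junctionStep_eq_zero {N : ℕ} {w : ℝ} (hw : 0 < w) {j : ℕ} {t : ℝ}
    (ht : w < |t - sample N j|) : deriv (junctionStep N w j) t = 0 := by
  have hab : sample N j - w < sample N j + w := by linarith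
  rcases lt_abs.1 ht with h | h
  · exact deriv_smoothStep_of_gt hab (by linarith)
  · exact deriv_smoothStep_of_lt hab (by linarith)

/-- The **glued map** `g = p₀ + ∑_{j=1}^{2N-1} ζⱼ(x₀) • (pⱼ - pⱼ₋₁)` (a telescoping smooth
partition of unity in the core direction; EM's `F̃ = Gⁱ` over the `i`-th slab).
[cite: EliashbergMishachev2001, Lemma 1.3.2] -/
def glued (θ : ℝ → ℝ) (f : ℝ → 𝔼₂ → F) (N : ℕ) (w : ℝ) (x : 𝔼₂) : F :=
  piece θ f N 0 x + ∑ j ∈ Finset.Icc 1 (2 * N - 1),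
    junctionStep N w j (x 0) • (piece θ f N j x - piece θ f N (j - 1) x)

/-- The glued map is `C^∞`. [folklore] -/
theorem contDiff_glued {θ : ℝ → ℝ} (hθ : ContDiff ℝ ∞ θ) {f : ℝ → 𝔼₂ → F}
    (hf : ∀ s, ContDiff ℝ ∞ (f s)) (N : ℕ) (w : ℝ) : ContDiff ℝ ∞ (glued θ f N w) := by
  unfold glued
  refine (contDiff_piece hθ hf N 0).add (ContDiff.sum fun j _ => ?_)
  refine ContDiff.smul ?_ ((contDiff_piece hθ hf N j).sub (contDiff_piece hθ hf N (j - 1)))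
  have h0 : ContDiff ℝ ∞ fun x : 𝔼₂ => x 0 :=
    (EuclideanSpace.proj (0 : Fin (n + 2)) : 𝔼₂ →L[ℝ] ℝ).contDiff
  exact (contDiff_smoothStep _ _).comp h0

/-- **Derivative of the glued map**: the sum of `ζⱼ(x₀) • (D pⱼ - D pⱼ₋₁)` and of the gluing
terms `ζⱼ'(x₀) e₀* ⊗ (pⱼ x - pⱼ₋₁ x)`. [cite: EliashbergMishachev2001, Lemma 1.3.2] -/
theorem hasFDerivAt_glued {θ : ℝ → ℝ} (hθ : ContDiff ℝ ∞ θ) {f : ℝ → 𝔼₂ → F}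
    (hf : ∀ s, ContDiff ℝ ∞ (f s)) (N : ℕ) (w : ℝ) (x : 𝔼₂) :
    HasFDerivAt (glued θ f N w)
      (fderiv ℝ (piece θ f N 0) x + ∑ j ∈ Finset.Icc 1 (2 * N - 1),
        (junctionStep N w j (x 0) • (fderiv ℝ (piece θ f N j) x - fderiv ℝ (piece θ f N (j - 1)) x) +
          (deriv (junctionStep N w j) (x 0) •
            (EuclideanSpace.proj (0 : Fin (n + 2)) : 𝔼₂ →L[ℝ] ℝ)).smulRight
            (piece θ f N j x - piece θ f N (j - 1) x))) x := by
  have hp : ∀ j, HasFDerivAt (piece θ f N j) (fderiv ℝ (piece θ f N j) x) x := fun j =>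
    ((contDiff_piece hθ hf N j).differentiable (by simp) x).hasFDerivAt
  unfold glued
  refine (hp 0).add (HasFDerivAt.fun_sum fun j _ => ?_)
  have h0 : HasFDerivAt (fun y : 𝔼₂ => y 0) (EuclideanSpace.proj (0 : Fin (n + 2)) : 𝔼₂ →L[ℝ] ℝ) x :=
    (EuclideanSpace.proj (0 : Fin (n + 2)) : 𝔼₂ →L[ℝ] ℝ).hasFDerivAt
  have hζ : HasFDerivAt (fun y : 𝔼₂ => junctionStep N w j (y 0))
      (deriv (junctionStep N w j) (x 0) • (EuclideanSpace.proj (0 : Fin (n + 2)) : 𝔼₂ →L[ℝ] ℝ))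
      x := by
    have hd : HasDerivAt (junctionStep N w j) (deriv (junctionStep N w j) (x 0)) (x 0) :=
      ((contDiff_smoothStep _ _).differentiable (by simp) _).hasDerivAt
    exact hd.comp_hasFDerivAt x h0
  exact hζ.smul ((hp j).sub (hp (j - 1)))

/-! ### The structure of the junction cut-offs: a two-piece convex combination -/

/-- **Telescoping**: `a₀ + ∑_{j=1}^{k} (aⱼ - aⱼ₋₁) = a_k`. [folklore] -/
theorem add_sum_Icc_sub_eq {G : Type*} [AddCommGroup G] (a : ℕ → G) (k : ℕ) :
    a 0 + ∑ j ∈ Finset.Icc 1 k, (a j - a (j - 1)) = a k := by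
  induction k with
  | zero => simp
  | succ k ih =>
    rw [Finset.sum_Icc_succ_top (by omega), ← add_assoc, ih]
    simp

/-- **A telescoping sum with weights `1, …, 1, λ, 0, …, 0` is a two-piece combination**: if
`z j = 1` for `1 ≤ j ≤ k` and `z j = 0` for `k + 2 ≤ j ≤ M` (`k ≤ M`), then
`a₀ + ∑_{j=1}^{M} z j • (aⱼ - aⱼ₋₁) = a_k + [k + 1 ≤ M] z (k+1) • (a_{k+1} - a_k)`. [folklore] -/
theorem add_sum_smul_sub_eq {G : Type*} [AddCommGroup G] [Module ℝ G] (z : ℕ → ℝ) (a : ℕ → G)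
    {M k : ℕ} (hk : k ≤ M) (h1 : ∀ j, 1 ≤ j → j ≤ k → z j = 1)
    (h0 : ∀ j, k + 2 ≤ j → j ≤ M → z j = 0) :
    a 0 + ∑ j ∈ Finset.Icc 1 M, z j • (a j - a (j - 1)) =
      a k + if k + 1 ≤ M then z (k + 1) • (a (k + 1) - a k) else 0 := by
  -- split the range `[1, M]` into `[1, k]`, `{k + 1}` (if present) and `[k + 2, M]`
  have hsplit : Finset.Icc 1 M = Finset.Icc 1 k ∪ Finset.Icc (k + 1) M := by
    ext j
    simp only [Finset.mem_union, Finset.mem_Icc]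
    omega
  have hdisj : Disjoint (Finset.Icc 1 k) (Finset.Icc (k + 1) M) := by
    rw [Finset.disjoint_left]
    intro j hj hj'
    simp only [Finset.mem_Icc] at hj hj'
    omega
  rw [hsplit, Finset.sum_union hdisj]
  have hfirst : ∑ j ∈ Finset.Icc 1 k, z j • (a j - a (j - 1)) =
      ∑ j ∈ Finset.Icc 1 k, (a j - a (j - 1)) := by
    refine Finset.sum_congr rfl fun j hj => ?_
    simp only [Finset.mem_Icc] at hj
    rw [h1 j hj.1 hj.2, one_smul]
  rw [hfirst, ← add_assoc, add_sum_Icc_sub_eq a k]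
  congr 1
  by_cases hkM : k + 1 ≤ M
  · rw [if_pos hkM]
    have hsplit' : Finset.Icc (k + 1) M = insert (k + 1) (Finset.Icc (k + 2) M) := by
      ext j
      simp only [Finset.mem_insert, Finset.mem_Icc]
      omega
    rw [hsplit', Finset.sum_insert (by simp)]
    have hrest : ∑ j ∈ Finset.Icc (k + 2) M, z j • (a j - a (j - 1)) = 0 := by
      refine Finset.sum_eq_zero fun j hj => ?_
      simp only [Finset.mem_Icc] at hj
      rw [h0 j hj.1 hj.2, zero_smul]
    rw [hrest, add_zero]
    simp
  · rw [if_neg hkM]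
    have : Finset.Icc (k + 1) M = ∅ := by
      ext j
      simp only [Finset.mem_Icc, Finset.notMem_empty, iff_false]
      omega
    rw [this, Finset.sum_empty]

/-- **The junction cut-offs take the values `1, …, 1, λ, 0, …, 0`.** If the windows are
disjoint (`2w < 1/(2N)`), then for every `t` there is `k ≤ M` with `ζⱼ(t) = 1` for
`1 ≤ j ≤ k` and `ζⱼ(t) = 0` for `k + 2 ≤ j ≤ M`; namely `k` = the largest `j ≤ M` with
`s_j + w ≤ t` (or `0`). Moreover if `k + 1 ≤ M` and `ζ_{k+1}(t) ≠ 0` then `t` lies in the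
`(k+1)`-st window from the left: `s_{k+1} - w < t < s_{k+1} + w`. [folklore] -/
theorem exists_junctionStep_pattern {N : ℕ} (hN : 0 < N) {w : ℝ} (hw : 0 < w)
    (hw' : 2 * w < 1 / (2 * N)) (M : ℕ) (t : ℝ) :
    ∃ k ≤ M, (∀ j, 1 ≤ j → j ≤ k → junctionStep N w j t = 1) ∧
      (∀ j, k + 2 ≤ j → j ≤ M → junctionStep N w j t = 0) ∧
      (1 ≤ k → sample N k + w ≤ t) ∧
      (k + 1 ≤ M → t < sample N (k + 1) + w) := by
  classical
  set k := Nat.findGreatest (fun j => sample N j + w ≤ t) M with hk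
  refine ⟨k, Nat.findGreatest_le M, fun j hj1 hjk => ?_, fun j hkj hjM => ?_, fun hk1 => ?_,
    fun hkM => ?_⟩
  · -- `j ≤ k`: `s_j + w ≤ s_k + w ≤ t`
    have hk0 : k ≠ 0 := by omega
    have hkspec : sample N k + w ≤ t := Nat.findGreatest_of_ne_zero hk.symm hk0
    exact junctionStep_of_ge hw (by linarith [sample_le_sample hN hjk])
  · -- `k + 2 ≤ j`: `t < s_{k+1} + w ≤ s_j - w`
    have hnot : ¬ (sample N (k + 1) + w ≤ t) :=
      Nat.findGreatest_is_greatest (Nat.lt_succ_self k) (by omega)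
    have hlt : t < sample N (k + 1) + w := lt_of_not_ge hnot
    refine junctionStep_of_le hw ?_
    have hstep : sample N (k + 1) + 1 / (2 * N) ≤ sample N j := by
      have := sample_succ_sub hN (k + 1)
      have h2 : sample N (k + 2) ≤ sample N j := sample_le_sample hN hkj
      linarith
    linarith
  · have hk0 : k ≠ 0 := by omega
    exact Nat.findGreatest_of_ne_zero hk.symm hk0
  · exact lt_of_not_ge (Nat.findGreatest_is_greatest (Nat.lt_succ_self k) hkM)

/-! ### The family and the estimates for the pieces -/

/-- **The data of EM's Interpolation Property along the segment** (proof of Lemma 1.3.2 with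
`l = 1`, `k = 1`): a family `(f_s)` of `C^∞` maps, jointly continuous together with its
`x`-derivative, whose `1`-jets are `ε/4`-close to `(F₀, F₁)` on the balls of radius `d` about
the core points `c(s)`, `s ∈ [0, 1]`, and which is constant (`= f₀`, `= f₁`) for `s ≤ η`,
`s ≥ 1 - η`. In EM's proof `f_s` is the given fibrewise-holonomic family `F_{y,t}` (for the base
step: affine Taylor sections blended with the given holonomic end data).
[cite: EliashbergMishachev2001, Lemma 1.3.2] -/
structure IsGluingFamily (f : ℝ → EuclideanSpace ℝ (Fin (n + 2)) → F)
    (F₀ : EuclideanSpace ℝ (Fin (n + 2)) → F)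
    (F₁ : EuclideanSpace ℝ (Fin (n + 2)) → EuclideanSpace ℝ (Fin (n + 2)) →L[ℝ] F)
    (ε d η : ℝ) : Prop where
  contDiff : ∀ s, ContDiff ℝ ∞ (f s)
  continuous : Continuous fun q : ℝ × EuclideanSpace ℝ (Fin (n + 2)) => f q.1 q.2
  continuous_fderiv : Continuous fun q : ℝ × EuclideanSpace ℝ (Fin (n + 2)) => fderiv ℝ (f q.1) q.2
  d_pos : 0 < d
  approx : ∀ s ∈ Icc (0 : ℝ) 1, ∀ x ∈ ball (coreLine n s) d,
    ‖f s x - F₀ x‖ < ε / 4 ∧ ‖fderiv ℝ (f s) x - F₁ x‖ < ε / 4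
  η_pos : 0 < η
  eq_left : ∀ s, s ≤ η → f s = f 0
  eq_right : ∀ s, 1 - η ≤ s → f s = f 1

/-- The transverse coordinate functional has norm `≤ 1`. [folklore] -/
theorem norm_projOne_le : ‖(projOne n : 𝔼₂ →L[ℝ] ℝ)‖ ≤ 1 := by
  refine ContinuousLinearMap.opNorm_le_bound _ zero_le_one fun x => ?_
  rw [one_mul]
  exact PiLp.norm_apply_le x 1

/-- A coordinate is bounded by the norm: `|xᵢ| ≤ ‖x‖`. [folklore] -/
theorem abs_apply_le_norm (x : 𝔼₂) (i : Fin (n + 2)) : |x i| ≤ ‖x‖ := by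
  have h := PiLp.norm_apply_le x i
  rwa [Real.norm_eq_abs] at h

/-- **Estimates for the pieces** (EM 2001, Interpolation Property (b): `‖Gⁱ - Fⁱ‖ < ε`). If `x`
is within distance `d` of the core points `c(s_{c'})` for the (at most three) sample indices
`c'` used by the piece `p_m`, `‖x‖ ≤ 3`, the cut-off `θ` is `[0,1]`-valued with slope `≤ K`,
and consecutive samples are `τ`-close where `τ` makes members of the family
`ε/(4(K+1))`-close on `‖x‖ ≤ 3`, then the `1`-jet of `p_m` at `x` is `ε/2`-close to `(F₀, F₁)`.
[cite: EliashbergMishachev2001, Lemma 1.3.2] -/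
theorem piece_approx {f : ℝ → 𝔼₂ → F} {F₀ : 𝔼₂ → F} {F₁ : 𝔼₂ → 𝔼₂ →L[ℝ] F} {ε d η : ℝ}
    (hε : 0 < ε) (hfam : IsGluingFamily f F₀ F₁ ε d η) {θ : ℝ → ℝ} (hθs : ContDiff ℝ ∞ θ)
    (hθ01 : ∀ u, θ u ∈ Icc (0 : ℝ) 1) {K : ℝ} (hK : 0 ≤ K) (hθd : ∀ u, |deriv θ u| ≤ K)
    {N : ℕ} (hN : 0 < N) {τ : ℝ}
    (hτ : ∀ s ∈ Icc (-1 : ℝ) 2, ∀ s' ∈ Icc (-1 : ℝ) 2, |s - s'| ≤ τ →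
      ∀ x : 𝔼₂, ‖x‖ ≤ 3 → ‖f s x - f s' x‖ < ε / (4 * (K + 1)))
    (hNτ : 1 / (N : ℝ) ≤ τ) {x : 𝔼₂} (hxR : ‖x‖ ≤ 3) {m : ℕ} (hm : m + 1 ≤ 2 * N + 1)
    (hodd : ¬ Even m → m + 1 ≤ 2 * N)
    (hdist : ∀ c', (c' + 1 = m ∨ c' = m ∨ c' = m + 1) → c' ≤ 2 * N →
      ‖x - coreLine n (sample N c')‖ < d) :
    ‖piece θ f N m x - F₀ x‖ < ε / 2 ∧ ‖fderiv ℝ (piece θ f N m) x - F₁ x‖ < ε / 2 := by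
  have hs01 : ∀ c', c' ≤ 2 * N → sample N c' ∈ Icc (0 : ℝ) 1 := fun c' hc' => by
    refine ⟨by unfold sample; positivity, ?_⟩
    rw [← sample_two_mul hN]
    exact sample_le_sample hN hc'
  have happ : ∀ c', (c' + 1 = m ∨ c' = m ∨ c' = m + 1) → c' ≤ 2 * N →
      ‖f (sample N c') x - F₀ x‖ < ε / 4 ∧ ‖fderiv ℝ (f (sample N c')) x - F₁ x‖ < ε / 4 :=
    fun c' hc' hc'2 => hfam.approx _ (hs01 c' hc'2) x (mem_ball_iff_norm.2 (hdist c' hc' hc'2))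
  by_cases hpar : Even m
  · rw [piece_of_even hpar]
    obtain ⟨h0, h1⟩ := happ m (Or.inr (Or.inl rfl)) (by omega)
    exact ⟨by linarith, by linarith⟩
  · rw [piece_of_odd hpar]
    have hm1 : m + 1 ≤ 2 * N := hodd hpar
    have hm0 : 1 ≤ m := by
      rcases Nat.eq_zero_or_pos m with rfl | h
      · exact absurd (show Even 0 from ⟨0, rfl⟩) hpar
      · exact h
    obtain ⟨ha0, ha1⟩ := happ (m - 1) (Or.inl (by omega)) (by omega)
    obtain ⟨hb0, hb1⟩ := happ (m + 1) (Or.inr (Or.inr rfl)) hm1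
    set fa := f (sample N (m - 1)) with hfa
    set fb := f (sample N (m + 1)) with hfb
    have hθx := hθ01 (projOne n x)
    constructor
    · calc ‖transverseInterp θ (projOne n) fa fb x - F₀ x‖
          ≤ (1 - θ (projOne n x)) * ‖fa x - F₀ x‖ + θ (projOne n x) * ‖fb x - F₀ x‖ :=
            norm_transverseInterp_sub_le hθx.1 hθx.2 (F₀ x)
        _ ≤ (1 - θ (projOne n x)) * (ε / 4) + θ (projOne n x) * (ε / 4) := by
            gcongr
            · linarith [hθx.2]
            · exact hθx.1
        _ = ε / 4 := by ring
        _ < ε / 2 := by linarith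
    · -- the derivative of the interpolation
      have hfa' : HasFDerivAt fa (fderiv ℝ fa x) x :=
        ((hfam.contDiff _).differentiable (by simp) x).hasFDerivAt
      have hfb' : HasFDerivAt fb (fderiv ℝ fb x) x :=
        ((hfam.contDiff _).differentiable (by simp) x).hasFDerivAt
      have hθ' : HasDerivAt θ (deriv θ (projOne n x)) (projOne n x) :=
        (hθs.differentiable (by simp) _).hasDerivAt
      have hD := hasFDerivAt_transverseInterp (ℓ := projOne n) hθ' hfa' hfb'
      rw [hD.fderiv]
      -- consecutive members are close
      have hclose : ‖fb x - fa x‖ < ε / (4 * (K + 1)) := by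
        refine hτ _ ?_ _ ?_ ?_ x hxR
        · exact ⟨by linarith [(hs01 (m + 1) hm1).1], by linarith [(hs01 (m + 1) hm1).2]⟩
        · exact ⟨by linarith [(hs01 (m - 1) (by omega)).1],
            by linarith [(hs01 (m - 1) (by omega)).2]⟩
        · have h2 : sample N (m + 1) - sample N (m - 1) = 1 / N := by
            have := sample_add_two_sub hN (m - 1)
            rwa [show m - 1 + 2 = m + 1 by omega] at this
          rw [h2, abs_of_pos (by positivity)]
          exact hNτ
      have T := norm_fderiv_transverseInterp_sub_le hθx.1 hθx.2 (projOne n) (fderiv ℝ fa x)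
        (fderiv ℝ fb x) (F₁ x) (fb x - fa x) (θ' := deriv θ (projOne n x))
      have T1 : (1 - θ (projOne n x)) * ‖fderiv ℝ fa x - F₁ x‖ ≤ (1 - θ (projOne n x)) * (ε / 4) :=
        mul_le_mul_of_nonneg_left ha1.le (by linarith [hθx.2])
      have T2 : θ (projOne n x) * ‖fderiv ℝ fb x - F₁ x‖ ≤ θ (projOne n x) * (ε / 4) :=
        mul_le_mul_of_nonneg_left hb1.le hθx.1
      have T3 : |deriv θ (projOne n x)| * ‖projOne n‖ * ‖fb x - fa x‖ ≤
          K * 1 * (ε / (4 * (K + 1))) := by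
        apply mul_le_mul (mul_le_mul (hθd _) norm_projOne_le (norm_nonneg _) hK) hclose.le
          (norm_nonneg _) (by positivity)
      have hK1 : 0 < K + 1 := by linarith
      have hlt : K * (ε / (4 * (K + 1))) < ε / 4 := by
        rw [lt_div_iff₀ (by norm_num : (0 : ℝ) < 4)]
        have : K * (ε / (4 * (K + 1))) * 4 = ε * (K / (K + 1)) := by
          field_simp
        rw [this]
        have hfrac : K / (K + 1) < 1 := (div_lt_one hK1).2 (by linarith)
        nlinarith
      calc ‖fderiv ℝ fa x + (θ (projOne n x) • (fderiv ℝ fb x - fderiv ℝ fa x) +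
              (deriv θ (projOne n x) • projOne n).smulRight (fb x - fa x)) - F₁ x‖
          ≤ (1 - θ (projOne n x)) * ‖fderiv ℝ fa x - F₁ x‖ +
              θ (projOne n x) * ‖fderiv ℝ fb x - F₁ x‖ +
              |deriv θ (projOne n x)| * ‖projOne n‖ * ‖fb x - fa x‖ := T
        _ ≤ (1 - θ (projOne n x)) * (ε / 4) + θ (projOne n x) * (ε / 4) +
              K * 1 * (ε / (4 * (K + 1))) := add_le_add (add_le_add T1 T2) T3
        _ = ε / 4 + K * (ε / (4 * (K + 1))) := by ring
        _ < ε / 4 + ε / 4 := by linarith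
        _ = ε / 2 := by ring

/-! ### Agreement of consecutive pieces near the junctions -/

/-- `cos (π/12) ≥ 17/18` (from `1 - x²/2 ≤ cos x` and `π ≤ 4`). [folklore] -/
theorem cos_pi_div_twelve_ge : (17 : ℝ) / 18 ≤ Real.cos (π / 12) := by
  have h1 : 1 - (π / 12) ^ 2 / 2 ≤ Real.cos (π / 12) := Real.one_sub_sq_div_two_le_cos
  have h2 : (π / 12) ^ 2 ≤ 1 / 9 := by
    have hπ : π / 12 ≤ 1 / 3 := by linarith [Real.pi_le_four]
    have hπ0 : 0 ≤ π / 12 := by linarith [Real.pi_pos]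
    nlinarith
  linarith

/-- **Consecutive pieces agree near the junctions, along the wiggled core** (EM 2001, proof of
Lemma 1.3.2: `Gⁱ = Fⁱ⁺¹` on the top region, `= Fⁱ⁻¹` on the bottom one, and the wiggled cube
visits these regions at the junction slices). With cut-off `θ = smoothStep (-δ₀/2) (δ₀/2)`,
wiggle amplitude `δ₁ = 3δ₀/4` and a point `x` with `|x₀ - s_j| ≤ 1/(24N)` (`1 ≤ j ≤ 2N - 1`) and
`|x₁ - φ_N(x₀)| < δ₀/8`: `p_j x = p_{j-1} x`. Indeed `(-1)ʲ φ_N(x₀) ≥ (3δ₀/4) cos(π/12) > 5δ₀/8`, so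
`x₁ > δ₀/2` (`θ = 1`, both pieces are `f_{s_j}`) for even `j`, and `x₁ < -δ₀/2` (`θ = 0`, both
pieces are `f_{s_{j-1}}`) for odd `j`. [cite: EliashbergMishachev2001, Lemma 1.3.2] -/
theorem piece_eq_piece_pred {f : ℝ → 𝔼₂ → F} {δ₀ : ℝ} (hδ₀ : 0 < δ₀) {N : ℕ} (hN : 0 < N)
    {j : ℕ} (hj1 : 1 ≤ j) (hj2 : j + 1 ≤ 2 * N) {x : 𝔼₂}
    (hx0 : |x 0 - sample N j| ≤ 1 / (24 * N))
    (hx1 : |x 1 - wiggle N (3 * δ₀ / 4) (x 0)| < δ₀ / 8) :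
    piece (smoothStep (-(δ₀ / 2)) (δ₀ / 2)) f N j x =
      piece (smoothStep (-(δ₀ / 2)) (δ₀ / 2)) f N (j - 1) x := by
  have hN' : (0 : ℝ) < N := by exact_mod_cast hN
  have hab : -(δ₀ / 2) < δ₀ / 2 := by linarith
  -- the signed size of the wiggle at `x₀`
  have hw : (1 : ℝ) / (24 * N) ≤ 1 / (4 * N) :=
    one_div_le_one_div_of_le (by positivity) (by nlinarith)
  have hsigned := neg_one_pow_mul_wiggle_ge hN (by positivity : (0 : ℝ) ≤ 3 * δ₀ / 4) hj1 hj2 hw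
    (by rwa [sample_eq] at hx0)
  have hangle : 2 * π * N * (1 / (24 * N)) = π / 12 := by field_simp; ring
  rw [hangle] at hsigned
  have hbig : 5 * δ₀ / 8 < (-1) ^ j * wiggle N (3 * δ₀ / 4) (x 0) := by
    have := cos_pi_div_twelve_ge
    nlinarith
  obtain ⟨hx1l, hx1u⟩ := abs_sub_lt_iff.1 hx1
  by_cases hpar : Even j
  · -- even `j`: top region, `θ (x 1) = 1`
    have hsq : ((-1 : ℝ) ^ j) = 1 := Even.neg_one_pow hpar
    rw [hsq, one_mul] at hbig
    have hθ : smoothStep (-(δ₀ / 2)) (δ₀ / 2) (projOne n x) = 1 :=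
      smoothStep_of_ge hab (by show δ₀ / 2 ≤ x 1; linarith)
    have hodd : ¬ Even (j - 1) := by
      intro h
      obtain ⟨r, hr⟩ := hpar
      obtain ⟨r', hr'⟩ := h
      omega
    rw [piece_of_even hpar, piece_of_odd hodd, transverseInterp_of_eq_one hθ,
      show j - 1 + 1 = j by omega]
  · -- odd `j`: bottom region, `θ (x 1) = 0`
    have hsq : ((-1 : ℝ) ^ j) = -1 := Odd.neg_one_pow (Nat.not_even_iff_odd.1 hpar)
    rw [hsq, neg_one_mul] at hbig
    have hθ : smoothStep (-(δ₀ / 2)) (δ₀ / 2) (projOne n x) = 0 :=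
      smoothStep_of_le hab (by show x 1 ≤ -(δ₀ / 2); linarith)
    have heven : Even (j - 1) := by
      rcases Nat.even_or_odd (j - 1) with h | h
      · exact h
      · exfalso
        apply hpar
        obtain ⟨r, hr⟩ := h
        exact ⟨r + 1, by omega⟩
    rw [piece_of_odd hpar, piece_of_even heven, transverseInterp_of_eq_zero hθ]

/-! ### The gluing theorem -/

/-- For positive reals `a, b, c` there is a positive integer `N` with `1/N ≤ a, b, c`.
[folklore] -/
theorem exists_nat_one_div_le {a b c : ℝ} (ha : 0 < a) (hb : 0 < b) (hc : 0 < c) :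
    ∃ N : ℕ, 0 < N ∧ 1 / (N : ℝ) ≤ a ∧ 1 / (N : ℝ) ≤ b ∧ 1 / (N : ℝ) ≤ c := by
  obtain ⟨N, hN⟩ := exists_nat_ge (1 / a + 1 / b + 1 / c)
  have ha' : 0 < 1 / a := by positivity
  have hb' : 0 < 1 / b := by positivity
  have hc' : 0 < 1 / c := by positivity
  have hNpos : (0 : ℝ) < N := by linarith
  have hN0 : 0 < N := by exact_mod_cast hNpos
  refine ⟨N, hN0, ?_, ?_, ?_⟩
  · rw [div_le_iff₀ hNpos]
    calc (1 : ℝ) = a * (1 / a) := by field_simp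
      _ ≤ a * N := by gcongr; linarith
  · rw [div_le_iff₀ hNpos]
    calc (1 : ℝ) = b * (1 / b) := by field_simp
      _ ≤ b * N := by gcongr; linarith
  · rw [div_le_iff₀ hNpos]
    calc (1 : ℝ) = c * (1 / c) := by field_simp
      _ ≤ c * N := by gcongr; linarith

/-- `s_{2N-2} = 1 - 1/N`. [folklore] -/
theorem sample_two_mul_sub_two {N : ℕ} (hN : 0 < N) : sample N (2 * N - 2) = 1 - 1 / N := by
  have hN' : (N : ℝ) ≠ 0 := by exact_mod_cast hN.ne'
  have hcast : ((2 * N - 2 : ℕ) : ℝ) = 2 * N - 2 := by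
    rw [Nat.cast_sub (by omega), Nat.cast_mul]
    norm_num
  rw [sample, hcast]
  field_simp

/-- A convex combination is as close to a target as its ends:
`‖a + t • (b - a) - y‖ ≤ (1 - t) ‖a - y‖ + t ‖b - y‖` for `t ∈ [0, 1]`. [folklore] -/
theorem norm_add_smul_sub_sub_le {G : Type*} [SeminormedAddCommGroup G] [NormedSpace ℝ G]
    (a b y : G) {t : ℝ} (ht0 : 0 ≤ t) (ht1 : t ≤ 1) :
    ‖a + t • (b - a) - y‖ ≤ (1 - t) * ‖a - y‖ + t * ‖b - y‖ := by
  have hsplit : a + t • (b - a) - y = (1 - t) • (a - y) + t • (b - y) := by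
    simp only [smul_sub, sub_smul, one_smul]
    abel
  rw [hsplit]
  calc ‖(1 - t) • (a - y) + t • (b - y)‖ ≤ ‖(1 - t) • (a - y)‖ + ‖t • (b - y)‖ := norm_add_le _ _
    _ = (1 - t) * ‖a - y‖ + t * ‖b - y‖ := by
        rw [norm_smul, norm_smul, Real.norm_of_nonneg (sub_nonneg.2 ht1), Real.norm_of_nonneg ht0]
set_option maxHeartbeats 400000 in -- buildfix (bf3-g26): 160k/180k FAIL, 200k PASS at accept time; line-neutral budget line
/-- **Gluing a continuous family of holonomic sections along a wiggled segment**
(Eliashberg–Mishachev 2001, proof of the Inductional Lemma 1.3.2 for a one-dimensional cube and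
the fibration by points). Let `(f_s)` be a gluing family for the `1`-jet section `(F₀, F₁)` at
precision `ε/4` on `d`-balls about the core `c([0, 1])`, constant near the ends
(`IsGluingFamily`). Then for every `δ > 0` there are `N`, an amplitude `0 < δ₁ ≤ δ`, a `C^∞` map
`g` and an open set `Ω` containing the wiggled core `h(c(s))`, `s ∈ [0, 1]`,
`h = shear (φ_N) 0 1` the shear by the wiggle `φ_N = wiggle N δ₁` (`|φ_N| ≤ δ₁`, `φ_N = 0` near
the ends), such that the `1`-jet of `g` is `ε`-close to `(F₀, F₁)` on `Ω`, and `g = f₀` on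
`{x₀ < r}`, `g = f₁` on `{x₀ > 1 - r}` for some `r > 0`. The map is
`g = p₀ + ∑ⱼ ζⱼ(x₀) (pⱼ - pⱼ₋₁)` (`glued`), and
`Ω = {-w < x₀ < 1 + w, ‖x - h(c(x₀))‖ < δ₀/8}`. [cite: EliashbergMishachev2001, Lemma 1.3.2] -/
theorem exists_glue_family_along_wiggle {f : ℝ → 𝔼₂ → F} {F₀ : 𝔼₂ → F} {F₁ : 𝔼₂ → 𝔼₂ →L[ℝ] F}
    {ε d η : ℝ} (hε : 0 < ε) (hfam : IsGluingFamily f F₀ F₁ ε d η) {δ : ℝ} (hδ : 0 < δ) :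
    ∃ (N : ℕ) (δ₁ : ℝ), 0 < N ∧ 0 < δ₁ ∧ δ₁ ≤ δ ∧
      ∃ (g : 𝔼₂ → F) (Ω : Set 𝔼₂), ContDiff ℝ ∞ g ∧ IsOpen Ω ∧
        (∀ s ∈ Icc (0 : ℝ) 1, shear (wiggle N δ₁) 0 1 (coreLine n s) ∈ Ω) ∧
        (∀ x ∈ Ω, ‖g x - F₀ x‖ < ε ∧ ‖fderiv ℝ g x - F₁ x‖ < ε) ∧
        (∃ r > 0, ∀ x : 𝔼₂, x 0 < r → g x = f 0 x) ∧
        (∃ r > 0, ∀ x : 𝔼₂, 1 - r < x 0 → g x = f 1 x) := by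
  have hd := hfam.d_pos
  have hη := hfam.η_pos
  -- the transverse scale `δ₀`
  set δ₀ : ℝ := min (min δ (d / 8)) 1 with hδ₀
  have hδ₀pos : 0 < δ₀ := lt_min (lt_min hδ (by linarith)) one_pos
  have hδ₀δ : δ₀ ≤ δ := (min_le_left _ _).trans (min_le_left _ _)
  have hδ₀d : δ₀ ≤ d / 8 := (min_le_left _ _).trans (min_le_right _ _)
  have hδ₀1 : δ₀ ≤ 1 := min_le_right _ _
  -- the cut-off `θ` and its slope
  set θ : ℝ → ℝ := smoothStep (-(δ₀ / 2)) (δ₀ / 2) with hθ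
  have hθs : ContDiff ℝ ∞ θ := contDiff_smoothStep _ _
  have hθ01 : ∀ u, θ u ∈ Icc (0 : ℝ) 1 := fun u => smoothStep_mem_Icc _ _ _
  obtain ⟨K, hK0, hK⟩ := exists_abs_deriv_smoothStep_le (a := -(δ₀ / 2)) (b := δ₀ / 2)
    (by linarith)
  -- uniform continuity modulus of the family
  have hεK : 0 < ε / (4 * (K + 1)) := by positivity
  obtain ⟨τ, hτ, hτ'⟩ := exists_forall_norm_sub_lt_of_continuous_family hfam.continuous 3 hεK
  -- the number of samples
  obtain ⟨N, hN, hNτ, hNη, hNδ⟩ := exists_nat_one_div_le hτ hη hδ₀pos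
  have hN' : (0 : ℝ) < N := by exact_mod_cast hN
  have h2N : (1 : ℝ) / (2 * N) = (1 / N) / 2 := by field_simp
  -- amplitude, window, wiggle, glued map, region
  set δ₁ : ℝ := 3 * δ₀ / 4 with hδ₁
  set w : ℝ := 1 / (48 * N) with hw
  have hwpos : 0 < w := by positivity
  have hwN : w = (1 / N) / 48 := by rw [hw]; field_simp
  have hw' : 2 * w < 1 / (2 * N) := by rw [hwN, h2N]; linarith [show 0 < 1 / (N : ℝ) by positivity]
  have h24 : 2 * w = 1 / (24 * N) := by rw [hw]; field_simp; ring
  set φ : ℝ → ℝ := wiggle N δ₁ with hφ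
  set g : 𝔼₂ → F := glued θ f N w with hg
  have hc0 : Continuous fun x : 𝔼₂ => x 0 := (EuclideanSpace.proj (0 : Fin (n + 2)) : 𝔼₂ →L[ℝ] ℝ).continuous
  set Ω : Set 𝔼₂ := {x | -w < x 0} ∩ ({x | x 0 < 1 + w} ∩
    {x | ‖x - shear φ 0 1 (coreLine n (x 0))‖ < δ₀ / 8}) with hΩ
  have hΩ_open : IsOpen Ω := by
    refine (isOpen_lt continuous_const hc0).inter ((isOpen_lt hc0 continuous_const).inter ?_)
    refine isOpen_lt ?_ continuous_const
    exact continuous_norm.comp (continuous_id.sub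
      ((continuous_shear (continuous_wiggle N δ₁) 0 1).comp (continuous_coreLine.comp hc0)))
  have h01 : (0 : Fin (n + 2)) ≠ 1 := by simp
  refine ⟨N, δ₁, hN, by positivity, by linarith, g, Ω, contDiff_glued hθs hfam.contDiff N w,
    hΩ_open, ?_, ?_, ?_, ?_⟩
  · -- the wiggled core lies in `Ω`
    intro s hs
    have hx0 : shear φ 0 1 (coreLine n s) 0 = s := by
      rw [shear_apply_fst φ h01, coreLine_apply_zero]
    refine ⟨?_, ?_, ?_⟩
    · show -w < shear φ 0 1 (coreLine n s) 0
      rw [hx0]; linarith [hs.1]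
    · show shear φ 0 1 (coreLine n s) 0 < 1 + w
      rw [hx0]; linarith [hs.2]
    · show ‖shear φ 0 1 (coreLine n s) - shear φ 0 1 (coreLine n (shear φ 0 1 (coreLine n s) 0))‖ < δ₀ / 8
      rw [hx0, sub_self, norm_zero]
      positivity
  · -- the estimates on `Ω`
    rintro x ⟨hxl, hxu, hxκ⟩
    simp only [mem_setOf_eq] at hxl hxu hxκ
    -- geometry of `x`
    have hx1 : |x 1 - φ (x 0)| < δ₀ / 8 := by
      have h := abs_apply_le_norm (x - shear φ 0 1 (coreLine n (x 0))) 1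
      have hcoord : (x - shear φ 0 1 (coreLine n (x 0))) 1 = x 1 - φ (x 0) := by
        rw [show (x - shear φ 0 1 (coreLine n (x 0))) 1 = x 1 - shear φ 0 1 (coreLine n (x 0)) 1
          from rfl, shear_apply_same, coreLine_apply_zero, coreLine_apply_of_ne _ h01.symm,
          zero_add]
      rw [hcoord] at h
      exact h.trans_lt hxκ
    have hdist_core : ∀ s', ‖x - coreLine n s'‖ ≤ δ₀ / 8 + δ₁ + |x 0 - s'| := by
      intro s'
      have hmove : ‖shear φ 0 1 (coreLine n (x 0)) - coreLine n (x 0)‖ ≤ δ₁ := by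
        rw [norm_shear_sub, coreLine_apply_zero]
        exact abs_wiggle_le N (by positivity) _
      calc ‖x - coreLine n s'‖
          ≤ ‖x - coreLine n (x 0)‖ + ‖coreLine n (x 0) - coreLine n s'‖ := norm_sub_le_norm_sub_add_norm_sub _ _ _
        _ ≤ (‖x - shear φ 0 1 (coreLine n (x 0))‖ +
              ‖shear φ 0 1 (coreLine n (x 0)) - coreLine n (x 0)‖) + |x 0 - s'| := by
            rw [norm_coreLine_sub]
            gcongr
            exact norm_sub_le_norm_sub_add_norm_sub _ _ _
        _ ≤ δ₀ / 8 + δ₁ + |x 0 - s'| := by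
            gcongr
    have hxR : ‖x‖ ≤ 3 := by
      have h := hdist_core (x 0)
      rw [sub_self, abs_zero, add_zero] at h
      have hc : ‖coreLine n (x 0)‖ ≤ 1 + w := by
        have := norm_coreLine_sub (n := n) (x 0) 0
        rw [coreLine, coreLine] at this
        rw [show ‖coreLine n (x 0)‖ = |x 0| by
          have h' := norm_coreLine_sub (n := n) (x 0) 0
          simpa [coreLine, sub_zero] using h']
        rw [abs_le]
        constructor <;> linarith
      calc ‖x‖ ≤ ‖x - coreLine n (x 0)‖ + ‖coreLine n (x 0)‖ := norm_le_norm_sub_add _ _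
        _ ≤ (δ₀ / 8 + δ₁) + (1 + w) := add_le_add h hc
        _ ≤ 3 := by
            rw [hδ₁, hwN]
            have : 1 / (N : ℝ) ≤ 1 := by
              rw [div_le_one hN']; exact_mod_cast hN
            linarith
    -- the pattern of the junction cut-offs at `x₀`
    obtain ⟨k, hkM, h1, h0, hklow, hkup⟩ := exists_junctionStep_pattern hN hwpos hw' (2 * N - 1) (x 0)
    -- distances to the relevant sample points
    have hs_succ : ∀ j : ℕ, sample N (j + 1) = sample N j + 1 / (2 * N) := fun j => by
      linarith [sample_succ_sub hN j]
    have hbound_k : |x 0 - sample N k| ≤ 1 / (2 * N) + w := by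
      rw [abs_le]
      constructor
      · -- lower bound
        by_cases hk1 : 1 ≤ k
        · linarith [hklow hk1]
        · have hk0 : k = 0 := by omega
          subst hk0
          rw [sample_zero]
          have : (0 : ℝ) < 1 / (2 * N) := by positivity
          linarith
      · by_cases hkM' : k + 1 ≤ 2 * N - 1
        · have := hkup hkM'
          rw [hs_succ] at this
          linarith
        · have hk2 : k = 2 * N - 1 := by omega
          have hsk : sample N k + 1 / (2 * N) = 1 := by
            rw [← hs_succ, hk2, show 2 * N - 1 + 1 = 2 * N by omega, sample_two_mul hN]
          linarith
    have hbound_k1 : k + 1 ≤ 2 * N - 1 → |x 0 - sample N (k + 1)| ≤ 1 / (2 * N) + w := by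
      intro hkM'
      rw [abs_le]
      constructor
      · by_cases hk1 : 1 ≤ k
        · have := hklow hk1
          rw [hs_succ]
          linarith
        · have hk0 : k = 0 := by omega
          subst hk0
          rw [hs_succ, sample_zero]
          linarith
      · linarith [hkup hkM']
    -- the piece estimates at `x`
    have hpiece : ∀ m, m ≤ 2 * N - 1 → |x 0 - sample N m| ≤ 1 / (2 * N) + w →
        ‖piece θ f N m x - F₀ x‖ < ε / 2 ∧ ‖fderiv ℝ (piece θ f N m) x - F₁ x‖ < ε / 2 := by
      intro m hm hxm
      refine piece_approx hε hfam hθs hθ01 hK0 hK hN hτ' hNτ hxR (by omega) (fun _ => by omega)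
        fun c' hc' hc'N => ?_
      have hcm : |sample N m - sample N c'| ≤ 1 / (2 * N) := by
        rcases hc' with h | h | h
        · rw [← h, hs_succ, add_sub_cancel_left, abs_of_pos (by positivity)]
        · rw [h, sub_self, abs_zero]; positivity
        · rw [h, hs_succ, sub_add_cancel_left, abs_neg, abs_of_pos (by positivity)]
      have htri : |x 0 - sample N c'| ≤ (1 / (2 * N) + w) + 1 / (2 * N) := by
        calc |x 0 - sample N c'| = |(x 0 - sample N m) + (sample N m - sample N c')| := by ring_nf
          _ ≤ |x 0 - sample N m| + |sample N m - sample N c'| := abs_add_le _ _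
          _ ≤ _ := add_le_add hxm hcm
      calc ‖x - coreLine n (sample N c')‖ ≤ δ₀ / 8 + δ₁ + |x 0 - sample N c'| := hdist_core _
        _ ≤ δ₀ / 8 + δ₁ + ((1 / (2 * N) + w) + 1 / (2 * N)) := by gcongr
        _ < d := by
            rw [hδ₁, hwN, h2N]
            nlinarith
    -- the gluing terms vanish on `Ω`
    have hglue : ∀ j ∈ Finset.Icc 1 (2 * N - 1),
        (deriv (junctionStep N w j) (x 0) •
          (EuclideanSpace.proj (0 : Fin (n + 2)) : 𝔼₂ →L[ℝ] ℝ)).smulRight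
          (piece θ f N j x - piece θ f N (j - 1) x) = 0 := by
      intro j hj
      simp only [Finset.mem_Icc] at hj
      by_cases hnear : |x 0 - sample N j| < 2 * w
      · have heq : piece θ f N j x = piece θ f N (j - 1) x := by
          refine piece_eq_piece_pred (f := f) hδ₀pos hN hj.1 (by omega) ?_ ?_
          · rw [← h24]; exact hnear.le
          · exact hx1
        rw [heq, sub_self]
        ext v
        simp
      · have hfar : w < |x 0 - sample N j| := by linarith [not_lt.1 hnear]
        rw [deriv_junctionStep_eq_zero hwpos hfar, zero_smul]
        ext v
        simp
    -- the values and the derivative are two-piece convex combinations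
    have hval : g x = piece θ f N k x + (if k + 1 ≤ 2 * N - 1 then
        junctionStep N w (k + 1) (x 0) • (piece θ f N (k + 1) x - piece θ f N k x) else 0) := by
      rw [hg]
      exact add_sum_smul_sub_eq (fun j => junctionStep N w j (x 0)) (fun j => piece θ f N j x)
        hkM h1 h0
    have hder : fderiv ℝ g x = fderiv ℝ (piece θ f N k) x + (if k + 1 ≤ 2 * N - 1 then
        junctionStep N w (k + 1) (x 0) •
          (fderiv ℝ (piece θ f N (k + 1)) x - fderiv ℝ (piece θ f N k) x) else 0) := by
      rw [hg, (hasFDerivAt_glued hθs hfam.contDiff N w x).fderiv]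
      have hsum : ∑ j ∈ Finset.Icc 1 (2 * N - 1),
          (junctionStep N w j (x 0) •
              (fderiv ℝ (piece θ f N j) x - fderiv ℝ (piece θ f N (j - 1)) x) +
            (deriv (junctionStep N w j) (x 0) •
              (EuclideanSpace.proj (0 : Fin (n + 2)) : 𝔼₂ →L[ℝ] ℝ)).smulRight
              (piece θ f N j x - piece θ f N (j - 1) x)) =
          ∑ j ∈ Finset.Icc 1 (2 * N - 1), junctionStep N w j (x 0) •
              (fderiv ℝ (piece θ f N j) x - fderiv ℝ (piece θ f N (j - 1)) x) := by
        refine Finset.sum_congr rfl fun j hj => ?_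
        rw [hglue j hj, add_zero]
      rw [hsum]
      exact add_sum_smul_sub_eq (fun j => junctionStep N w j (x 0))
        (fun j => fderiv ℝ (piece θ f N j) x) hkM h1 h0
    obtain ⟨hk0, hk1'⟩ := hpiece k hkM hbound_k
    by_cases hkM' : k + 1 ≤ 2 * N - 1
    · rw [if_pos hkM'] at hval hder
      obtain ⟨hl0, hl1⟩ := hpiece (k + 1) hkM' (hbound_k1 hkM')
      have hlam := junctionStep_mem_Icc N w (k + 1) (x 0)
      constructor
      · rw [hval]
        calc _ ≤ (1 - junctionStep N w (k + 1) (x 0)) * ‖piece θ f N k x - F₀ x‖ +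
              junctionStep N w (k + 1) (x 0) * ‖piece θ f N (k + 1) x - F₀ x‖ :=
            norm_add_smul_sub_sub_le _ _ _ hlam.1 hlam.2
          _ ≤ (1 - junctionStep N w (k + 1) (x 0)) * (ε / 2) +
              junctionStep N w (k + 1) (x 0) * (ε / 2) := by
            gcongr
            · linarith [hlam.2]
            · exact hlam.1
          _ = ε / 2 := by ring
          _ < ε := by linarith
      · rw [hder]
        calc _ ≤ (1 - junctionStep N w (k + 1) (x 0)) * ‖fderiv ℝ (piece θ f N k) x - F₁ x‖ +
              junctionStep N w (k + 1) (x 0) * ‖fderiv ℝ (piece θ f N (k + 1)) x - F₁ x‖ :=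
            norm_add_smul_sub_sub_le _ _ _ hlam.1 hlam.2
          _ ≤ (1 - junctionStep N w (k + 1) (x 0)) * (ε / 2) +
              junctionStep N w (k + 1) (x 0) * (ε / 2) := by
            gcongr
            · linarith [hlam.2]
            · exact hlam.1
          _ = ε / 2 := by ring
          _ < ε := by linarith
    · rw [if_neg hkM', add_zero] at hval hder
      rw [hval, hder]
      exact ⟨by linarith, by linarith⟩
  · -- near the left end `g = f₀`
    refine ⟨1 / N - w, by rw [hwN]; linarith [show 0 < 1 / (N : ℝ) by positivity], fun x hx => ?_⟩
    have hs2 : sample N 2 = 1 / N := by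
      have := sample_add_two_sub hN 0
      simpa using this
    have h0' : ∀ j, 0 + 2 ≤ j → j ≤ 2 * N - 1 → junctionStep N w j (x 0) = 0 := by
      intro j hj _
      refine junctionStep_of_le hwpos ?_
      have : sample N 2 ≤ sample N j := sample_le_sample hN hj
      linarith
    have hval := add_sum_smul_sub_eq (fun j => junctionStep N w j (x 0)) (fun j => piece θ f N j x)
      (M := 2 * N - 1) (k := 0) (Nat.zero_le _) (fun j hj1 hj0 => by omega) h0'
    have hp0 : piece θ f N 0 x = f 0 x := by
      rw [piece_of_even ⟨0, rfl⟩, sample_zero]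
    have hp1 : piece θ f N 1 x = f 0 x := by
      have hodd : ¬ Even 1 := Nat.not_even_one
      rw [piece_of_odd hodd, show (1 : ℕ) - 1 = 0 from rfl, sample_zero,
        show (1 : ℕ) + 1 = 2 from rfl, hs2, hfam.eq_left _ hNη]
      exact transverseInterp_of_eq rfl
    show glued θ f N w x = f 0 x
    unfold glued
    rw [hval]
    simp only [hp0, hp1, sub_self, smul_zero]
    split_ifs <;> simp
  · -- near the right end `g = f₁`
    refine ⟨1 / N - w, by rw [hwN]; linarith [show 0 < 1 / (N : ℝ) by positivity], fun x hx => ?_⟩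
    have hs2 : sample N (2 * N - 2) = 1 - 1 / N := sample_two_mul_sub_two hN
    have h1' : ∀ j, 1 ≤ j → j ≤ 2 * N - 2 → junctionStep N w j (x 0) = 1 := by
      intro j _ hj
      refine junctionStep_of_ge hwpos ?_
      have : sample N j ≤ sample N (2 * N - 2) := sample_le_sample hN hj
      linarith
    have hval := add_sum_smul_sub_eq (fun j => junctionStep N w j (x 0)) (fun j => piece θ f N j x)
      (M := 2 * N - 1) (k := 2 * N - 2) (by omega) h1' (fun j hj hjM => by omega)
    have hpA : piece θ f N (2 * N - 2) x = f 1 x := by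
      rw [piece_of_even ⟨N - 1, by omega⟩, hs2, hfam.eq_right _ (by linarith)]
    have hpB : piece θ f N (2 * N - 1) x = f 1 x := by
      have hodd : ¬ Even (2 * N - 1) := by
        rintro ⟨r, hr⟩
        omega
      rw [piece_of_odd hodd, show 2 * N - 1 - 1 = 2 * N - 2 by omega,
        show 2 * N - 1 + 1 = 2 * N by omega, hs2, sample_two_mul hN, hfam.eq_right _ (by linarith)]
      exact transverseInterp_of_eq rfl
    show glued θ f N w x = f 1 x
    unfold glued
    rw [hval]
    simp only [hpA]
    rw [show 2 * N - 2 + 1 = 2 * N - 1 by omega]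
    simp only [hpB, sub_self, smul_zero]
    split_ifs <;> simp

end Literature.Topology.Immersions
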